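import Summits.BirchSwinnertonDyer.BirchSwinnertonDyer.Theses.UniversalToricDescent
import Mathlib.RingTheory.PowerSeries.Derivative
import HarnessLib

/-!
# NODE (D-0171) on crux stmt-BirchSwinnertonDyer-24207 `UniversalToricDescent.RationalSplitIMCInclusionAtThree`
# — idea `endoscopic-accumulating-reciprocity` (crux-ideate seat `cruxidea-stmt-BirchSwinnertonDyer-24207-1` gen 7, 2026-08-30)

KIND: DECOMPOSITION through a DOOR.  The wall `∃ k, 3ᵏ·L ∈ Ch_Λ(X_(∅,0))·R₀⟦T⟧` is entered through

  **S (sweep supply)** ∧ **I (identity principle at the BDP points)** ⟹ 24207   (kernel, BY NAME, below),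

and **I** is itself assembled from two typed analytic leaves **I₁ (the BDP points accumulate INSIDE the open disc)** and
**I₂ (Strassmann identity for `R₀⟦T⟧` on an interior-accumulating set)** (kernel, below).  A strictly WEAKER typed
first target **P (uniform value domination at the BDP points)** with its door **D (accumulation door)** and consequence
**P ⟹ on-closure root transfer** is recorded as the line's first lemma.

THE LEVER (two sentences).  (1) The interpolation points of `L = L^{BDP}` — `x = φ̂(γ) − 1`, `φ` unramified of
infinity type `(−n, n)`, `n > 0`, exactly the binders of the tree's `IsBDPLFunction` — ACCUMULATE AT INTERIOR POINTS of
the open unit disc (`φ ↦ φ^{1+3ᵏ}` gives `u^{1+3ᵏ} − 1 → u − 1`, `‖u − 1‖ < 1`), whereas the classical points `ζ − 1`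
only accumulate towards the rim; hence ANY `G ∈ R₀⟦T⟧` that agrees with `u·L` (`u` a unit) at the BDP points IS `u·L`
(**I**), so a Λ-adic explicit reciprocity law along the anticyclotomic line follows from POINTWISE reciprocity at
motivic points — the Λ-adic regulator through the supercuspidal block `V_f|G_{ℚ₃}` (wall K2 / `thin-comb` b-val) is
never computed, only Kato-type dual-exponential comparisons at de Rham points, which tolerate `3³ ∣ N`.  (2) Motivic
classes AT those points — `V_f ⊗ ψ` with `ψ` of infinity type `(−r, r)`, `r ≥ 1`, unreachable by every `GL₂ × CM`
construction (Heegner: trace zero; Beilinson–Flach with a classical CM form `θ_χ`: `χ` of type `(t, 0)` only, twist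
range `j ≤ min(2, k') − 2 = 0`; census N2 of gen 6) — are supplied by the ENDOSCOPIC `GU(2,1)` Euler system of
Loeffler–Skinner–Zerbes for `Π_r = ` the endoscopic lift of `(f ⊗ χ_a^{(r)}, χ_b^{(r)})` from `U(1,1) × U(1)`:
`V(Π_r)|G_K = V_f χ_a^{(r)} ⊕ χ_b^{(r)}`; at the split prime `𝔭` LSZ's "ordinary at `𝔭`" is the PARTIAL condition
"`P_𝔭(Π, qX)` has a unit root ⟺ a `1`-dimensional invariant subspace at `𝔭`" (arXiv:2010.10946, discussion before
Thm. 12.3.1, p. 24), which `χ_b` provides although `π₃ = π_{f,3}` is supercuspidal (`J_B(Π_𝔭) = 0` but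
`J_{P_{2,1}}(Π_𝔭) = π₃χ_a ⊠ χ_b ≠ 0`); by LSZ Rem. 10.2.6 (p. 21) partial ordinarity at `𝔭` gives classes over the
`𝔪𝔭^∞` ray-class tower (the `𝔭`-AXIS only — the `p^∞` tower needs ordinarity at `𝔭` AND `𝔭̄`, i.e. a nested flag at
`𝔭`, i.e. `V_f` ordinary: this CERTIFIES the lineage verdict that the anticyclotomic direction is not a tower variable
of any automorphic Euler system here), but the HEIGHT `r` of the tooth is free because `P_{2,1}`-ordinarity constrains
only the `GL₁`-block: the `P_{2,1}`-ordinary (semi-ordinary) family of endoscopic lifts, `r ∈ ℤ_{>0} ⊂ ℤ₃`, SWEEPS the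
anticyclotomic line through its crossing points `x_r` (type `(−r, r)`), which are precisely the BDP points of (1).

PIECES AND TAGS (evidence ids refer to `HANDOFF-cruxidea-24207-1-g7.md`).
* **S `EndoscopicSweepSupplyAtThree` [UNDECIDED · DOOR-HALF (given I it is EQUIVALENT to 24207: take `G = L`, `u = 1`)
  · leaves IDEA-NEEDED E1–E3 · INSTRUMENTABLE D-g7-2/3]**: `∃ G u k`, `u` a unit, `3ᵏ·G ∈ Ch·R₀⟦T⟧`, `G ≡ u·L` at the
  BDP points.  Meant: `G = Col_{𝔭'}(κ_ac)·c`, `κ_ac ∈ H¹_Iw(K_∞^{ac}, T_f)` (Λ-rank 2, NOT in `H¹_{Iw,(∅,0)} = 0`: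
  B-g5-1 evaded) the restriction to the crossing curve of the LRZ-interpolated LSZ classes of the semi-ordinary
  endoscopic family; `3ᵏ·G ∈ Ch` = the Λ-adic Kolyvagin bound (Mazur–Rubin) for the `V_f`-projection of the classes
  (tame norm relations: LSZ Thm. 12.3.1, Euler factor `P_w(Π) = P_w(fχ_a)·P_w(χ_b)`); `G ≡ u·L` = pointwise
  reciprocity at the motivic crossing points (`exp*` of the specialised class = `L(f, ψ_r⁻¹, 1)·L(χ_b …)` up to the
  interpolable factors of `bdpInterpolationValue`), `u` = the Katz factor of `χ_b` on the line (a unit on a chosen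
  branch: D-g7-2).  Untyped children (no `GU(2,1)` objects in the tree): E1 = LSZ norm relations at `P_{2,1}`-PARAHORIC
  level with a supercuspidal TYPE on the `GL₂`-block and reducible (endoscopic) `V` — printed LSZ Thm. 2 (p. 3) assumes
  `Π` unramified at `p` and `V` irreducible and uses Iwahori invariants (`Π_𝔭^{Ih} = 0` here); E2 = the pointwise
  reciprocity (LSZ p. 4: "in future work we will prove an explicit reciprocity law"); E3 = interpolation of E1 in the
  semi-ordinary weight family (Loeffler–Rockwood–Zerbes type) and non-vanishing of the `V_f`-component (D-g7-3).
* **I `IdentityPrincipleAtBDPPointsAtThree` [WEAKER · ATTACKABLE (M)]**, from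
  **I₁ `BDPPointsAccumulateAtThree` [WEAKER · ATTACKABLE (M): existence of unramified type-`(−n,n)` characters for `n`
  in an arithmetic progression (units of `K`), avatars (`exists_lAdic_isDeRhamFramed`), powers `φ^{1+3ᵏ}`]** and
  **I₂ `StrassmannIdentityAtThree` [WEAKER · ATTACKABLE (S): values exist on the open disc (coefficients of norm ≤ 1);
  rescale `T ↦ cT`, `‖x₀‖ < |c| < 1`; Strassmann]** — composition proved below.
* **P `UniformValueDominationAtBDPPointsAtThree` [WEAKER (strictly: decides only roots in the closure `𝒦` of the BDP
  points — B-g7-1: generic roots lie in `3·W(𝔽̄₃) ∖ 3·ℤ₃`, off `𝒦`) · IDEA-NEEDED (E1, E2 pointwise + UNIFORMITY of the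
  constant in `r`, which is E3 in disguise) ]**: `‖L(x)‖ ≤ 3^C·‖F(x)‖` at every BDP point, `(F) = Ch·R₀⟦T⟧`.
  **D `AccumulationDoorAtThree` [WEAKER · ATTACKABLE (S/M)]**: value domination on a set accumulating at an interior
  `x₀` ⟹ `ord_{x₀} L ≥ ord_{x₀} F`.  **P ⟹ `OnClosureRootTransferAtThree`** via D and I₁-type accumulation (stated).
* DEAD-LINE CERTIFICATE (lineage question g0 §"endoscopic road", g2, g60): the anticyclotomic line is NOT a tower
  variable of the LSZ `GU(2,1)` system for endoscopic `Π` — `p^∞`-tower ⟺ ordinary at `𝔭` and `𝔭̄` ⟺ `V|G_{K_𝔭}` has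
  a `1`- AND a `2`-dimensional invariant subspace carrying the smallest / two smallest Hodge–Tate weights ⟺ nested
  flag ⟺ `V_f` ordinary at `3` (false on O6 rows); Rem. 10.2.6 gives the `𝔭`-axis (= the LEAD's teeth).  What is
  NEW is orthogonal to that verdict: the WEIGHT variable of the semi-ordinary family carries the sweep.
BARRIERS honoured: `TraceZeroHeegnerTowerAtAdditiveSplitP` (no Heegner points), K1/B-g4-1 Kirillov (no toric measure
for `π₃` is posited; `L` exists by the route's frame W1), B1/B-g50-3 (`J_B(π₃) = 0`: respected — see the certificate;
`J_{P_{2,1}} ≠ 0` is what is used), `NoAdmissiblePrimesAtThree` (no level raising; tame relations at split primes),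
B-g5-1/B-g32-2 (the class is relaxed at both primes above `3`, not a universal norm of `H¹_f`), negatives index
(15532 `LeadingTermTamePinch_refuted`, 24881 `not_EquivariantChebotarevAtTwo`: unrelated).  No `Disproof.lean` is on
file for this crux.  References: LoefflerSkinnerZerbes2021 (arXiv:2010.10946) Thm. 2 (p. 3), Rem. 10.2.6 (p. 21),
Thm. 12.3.1 (p. 25), p. 24 (ordinarity), p. 4 (ERL future work); LoefflerZerbes ICM 2022 (doi:10.4171/icm2022/50);
CastellaHsieh2018 §3.3 (pointwise-to-Λ comparison at type `(n,−n)` characters); Castella2018 Thm. 3.1;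
BertoliniDarmonPrasanna2013 Thm. 5.13; Kato2004 Thm. 12.5; MazurRubin2004 (Kolyvagin systems); Nakamura2014
(arXiv:1201.6475 = JIMJ 13 (2014), big exponential for de Rham `(φ,Γ)`-modules); Strassmann 1928 / Washington GTM 83 §7.1.
-/

set_option linter.dupNamespace false

open scoped Classical

namespace Summit.BirchSwinnertonDyer.BirchSwinnertonDyer.Cruxes.RationalSplitIMCInclusionAtThree.EndoscopicAccumulatingReciprocity

open PowerSeries Literature.NumberTheory.EllipticCurves Literature.NumberTheory.GaloisRepresentations
  Summit.BirchSwinnertonDyer.Rank1Residual.X11b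

/-- **A BDP interpolation point** of the open disc for the data `(ι, κ, γ)`: `x = φ̂(γ) − 1` for an admissible triple
`(φ, n, r)` — VERBATIM the binders of the tree's `IsBDPLFunction` (`φ` unramified at every finite place, infinity type
`(−n, n)` in the tree's convention, `n > 0`, `r` a `3`-adic avatar of `φ` factoring through `κ`). -/
def IsBDPPoint {K : Type} [Field K] [NumberField K] (ι : PadicAlgCl 3 ≃+* ℂ) (κ : ZpExtension K 3)
    (γ : Field.absoluteGaloisGroup K) (x : ℂ_[3]) : Prop :=
  ∃ (φ : HeckeCharacter K) (n : ℕ) (r : FramedGaloisRep K (PadicAlgCl 3) 1),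
    0 < n ∧ (∀ v : IsDedekindDomain.HeightOneSpectrum (NumberField.RingOfIntegers K), φ.IsUnramifiedAt v) ∧
    φ.HasInfinityType (fun _ ↦ (n : ℤ)) (fun _ ↦ -(n : ℤ)) ∧
    IsPAdicAvatarOf ι φ r ∧ FactorsThroughZp κ r ∧ x = avatarValueAt r γ - 1

/-- `G` and `H` **agree at the BDP points** (values read through `UnrSeries.HasValueAt`; values exist on the open
disc, so this is genuine agreement there). -/
def AgreeAtBDPPoints {K : Type} [Field K] [NumberField K] (ι : PadicAlgCl 3 ≃+* ℂ) (κ : ZpExtension K 3)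
    (γ : Field.absoluteGaloisGroup K) (G H : UnrSeries 3) : Prop :=
  ∀ x : ℂ_[3], IsBDPPoint ι κ γ x → ∀ v w : ℂ_[3], G.HasValueAt x v → H.HasValueAt x w → v = w

/-- `G` vanishes to order `≥ n` at `x` (formal derivatives over `R₀`; as in the gen-6 node). -/
def VanishesToOrder (G : UnrSeries 3) (x : ℂ_[3]) (n : ℕ) : Prop :=
  ∀ i < n, ((fun H : UnrSeries 3 ↦ PowerSeries.derivative (unrIntegers 3) H)^[i] G).HasValueAt x 0

/-- **S [UNDECIDED · DOOR-HALF (EQUIV to 24207 given I) · IDEA-NEEDED E1–E3 · INSTRUMENTABLE D-g7-2/3]** the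
endoscopic sweep supply: on the wall's binders there are `G, u ∈ R₀⟦T⟧`, `u` a unit, and `k` with `3ᵏ·G ∈ Ch·R₀⟦T⟧`
and `G ≡ u·L` at every BDP point (meant: `G` = Coleman image of the Λ-adic endoscopic class, `3ᵏ·G ∈ Ch` = Λ-adic
Kolyvagin bound, agreement = pointwise reciprocity at the motivic crossing points, `u` = unit Katz branch). -/
def EndoscopicSweepSupplyAtThree : Prop :=
  ∀ (W : WeierstrassCurve ℚ) [W.IsElliptic] [W.IsGloballyMinimal] (N : ℕ) [NeZero N] (K : Type) [Field K] [NumberField K] (Dt : Literature.NumberTheory.EllipticCurves.ModularForms.ModularParametrizationData W N), Summit.BirchSwinnertonDyer.Rank1Residual.Additive.ClassO6 W 3 → W.HasSurjectiveModNGaloisRep 3 → W.analyticRank = 1 → W.conductorNorm ℤ = N → Literature.NumberTheory.EllipticCurves.IsImaginaryQuadratic K → Literature.NumberTheory.EllipticCurves.SatisfiesHeegnerHypothesis N K → ∀ (κ : Literature.NumberTheory.EllipticCurves.ZpExtension K 3), κ.IsAnticyclotomic → ∀ (γ : Field.absoluteGaloisGroup K) [Fact (κ.IsTopGenerator γ)]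 (𝔭 : IsDedekindDomain.HeightOneSpectrum (NumberField.RingOfIntegers K)), ((3 : ℕ) : NumberField.RingOfIntegers K) ∈ 𝔭.asIdeal → 𝔭.asIdeal.ramificationIdx (NumberField.RingOfIntegers ℚ) = 1 → 𝔭.asIdeal.inertiaDeg (NumberField.RingOfIntegers ℚ) = 1 → ∀ (𝔭' : IsDedekindDomain.HeightOneSpectrum (NumberField.RingOfIntegers K)), ((3 : ℕ) : NumberField.RingOfIntegers K) ∈ 𝔭'.asIdeal → 𝔭' ≠ 𝔭 → ∀ (ι' : PadicAlgCl 3 ≃+* ℂ), Summit.BirchSwinnertonDyer.BirchSwinnertonDyer.Theorems.SchneiderFree.BranchInducesPrime 3 ι' 𝔭 → ∀ (ΩK : ℂ) (Ωp : ℂ_[3]) (L : Literature.NumberTheory.EllipticCurves.UnrSeries 3), ΩK ≠ 0 → Ωp ≠ 0 → Literature.NumberTheory.EllipticCurves.IsBDPLFunction ι' 𝔭 κ γ Dt.f ΩK Ωp L →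
    ∃ (G u : UnrSeries 3) (k : ℕ), IsUnit u ∧
      ((3 : ℕ) : UnrSeries 3) ^ k * G ∈
        (Summit.BirchSwinnertonDyer.Rank1Residual.X11b.AcSelmer.XAc.charIdeal (W.baseChange K) 3 κ 𝔭' ∅ γ).map
          (PowerSeries.map (Summit.BirchSwinnertonDyer.Rank1Residual.X11b.Halves.toUnr 3)) ∧
      AgreeAtBDPPoints ι' κ γ G (u * L)

/-- **I [WEAKER · ATTACKABLE (M)]** the identity principle at the BDP points: for `K` imaginary quadratic, `κ` the
anticyclotomic `ℤ₃`-extension with topological generator `γ`, two series of `R₀⟦T⟧` that agree at every BDP point of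
`(ι, κ, γ)` are EQUAL (the BDP points accumulate at interior points of the disc). -/
def IdentityPrincipleAtBDPPointsAtThree : Prop :=
  ∀ (K : Type) [Field K] [NumberField K], Literature.NumberTheory.EllipticCurves.IsImaginaryQuadratic K →
    ∀ (κ : ZpExtension K 3), κ.IsAnticyclotomic → ∀ (γ : Field.absoluteGaloisGroup K) [Fact (κ.IsTopGenerator γ)]
      (ι : PadicAlgCl 3 ≃+* ℂ) (G H : UnrSeries 3), AgreeAtBDPPoints ι κ γ G H → G = H

/-- **I₁ [WEAKER · ATTACKABLE (M)]** the BDP points accumulate INSIDE the open disc: there is `x₀`, `‖x₀‖ < 1`, in the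
closure of the other BDP points of norm `< 1` (`φ ↦ φ^{1+3ᵏ}`: `u^{1+3ᵏ} − 1 → u − 1`). -/
def BDPPointsAccumulateAtThree : Prop :=
  ∀ (K : Type) [Field K] [NumberField K], Literature.NumberTheory.EllipticCurves.IsImaginaryQuadratic K →
    ∀ (κ : ZpExtension K 3), κ.IsAnticyclotomic → ∀ (γ : Field.absoluteGaloisGroup K) [Fact (κ.IsTopGenerator γ)]
      (ι : PadicAlgCl 3 ≃+* ℂ), ∃ x₀ : ℂ_[3], ‖x₀‖ < 1 ∧
        x₀ ∈ closure ({x : ℂ_[3] | IsBDPPoint ι κ γ x ∧ ‖x‖ < 1} \ {x₀})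

/-- **I₂ [WEAKER · ATTACKABLE (S)]** Strassmann identity for `R₀⟦T⟧`: two series agreeing (as values) on a subset of
the open disc that accumulates at an interior point are equal (values exist since the coefficients have norm `≤ 1`;
rescale to a closed sub-disc containing `x₀`; Strassmann's theorem). -/
def StrassmannIdentityAtThree : Prop :=
  ∀ (S : Set ℂ_[3]) (x₀ : ℂ_[3]), ‖x₀‖ < 1 → x₀ ∈ closure (S \ {x₀}) → (∀ x ∈ S, ‖x‖ < 1) →
    ∀ G H : UnrSeries 3, (∀ x ∈ S, ∀ v w : ℂ_[3], G.HasValueAt x v → H.HasValueAt x w → v = w) → G = H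

/-- **P [WEAKER (strictly) · IDEA-NEEDED (E1, E2, uniformity in `r`)]** uniform value domination at the BDP points:
with `X_(∅,0)` torsion and `(F) = Ch·R₀⟦T⟧`, one constant `C` with `‖L(x)‖ ≤ 3^C·‖F(x)‖` at every BDP point — the
output of UNIFORM pointwise Bloch–Kato bounds at the crossing points, with no Λ-adic class. -/
def UniformValueDominationAtBDPPointsAtThree : Prop :=
  ∀ (W : WeierstrassCurve ℚ) [W.IsElliptic] [W.IsGloballyMinimal] (N : ℕ) [NeZero N] (K : Type) [Field K] [NumberField K] (Dt : Literature.NumberTheory.EllipticCurves.ModularForms.ModularParametrizationData W N), Summit.BirchSwinnertonDyer.Rank1Residual.Additive.ClassO6 W 3 → W.HasSurjectiveModNGaloisRep 3 → W.analyticRank = 1 → W.conductorNorm ℤ = N → Literature.NumberTheory.EllipticCurves.IsImaginaryQuadratic K → Literature.NumberTheory.EllipticCurves.SatisfiesHeegnerHypothesis N K → ∀ (κ : Literature.NumberTheory.EllipticCurves.ZpExtension K 3), κ.IsAnticyclotomic → ∀ (γ : Field.absoluteGaloisGroup K) [Fact (κ.IsTopGenerator γ)] (𝔭 : IsDedekindDomain.HeightOneSpectrum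 (NumberField.RingOfIntegers K)), ((3 : ℕ) : NumberField.RingOfIntegers K) ∈ 𝔭.asIdeal → 𝔭.asIdeal.ramificationIdx (NumberField.RingOfIntegers ℚ) = 1 → 𝔭.asIdeal.inertiaDeg (NumberField.RingOfIntegers ℚ) = 1 → ∀ (𝔭' : IsDedekindDomain.HeightOneSpectrum (NumberField.RingOfIntegers K)), ((3 : ℕ) : NumberField.RingOfIntegers K) ∈ 𝔭'.asIdeal → 𝔭' ≠ 𝔭 → ∀ (ι' : PadicAlgCl 3 ≃+* ℂ), Summit.BirchSwinnertonDyer.BirchSwinnertonDyer.Theorems.SchneiderFree.BranchInducesPrime 3 ι' 𝔭 → ∀ (ΩK : ℂ) (Ωp : ℂ_[3]) (L : Literature.NumberTheory.EllipticCurves.UnrSeries 3), ΩK ≠ 0 → Ωp ≠ 0 → Literature.NumberTheory.EllipticCurves.IsBDPLFunction ι' 𝔭 κ γ Dt.f ΩK Ωp L → Module.IsTorsion (Literature.NumberTheory.EllipticCurves.IwasawaAlgebra 3) (Summit.BirchSwinnertonDyer.Rank1Residual.X11b.AcSelmer.XAc (W.baseChange K) 3 κ 𝔭' ∅ γ) →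 ∀ F : Literature.NumberTheory.EllipticCurves.UnrSeries 3, (Summit.BirchSwinnertonDyer.Rank1Residual.X11b.AcSelmer.XAc.charIdeal (W.baseChange K) 3 κ 𝔭' ∅ γ).map (PowerSeries.map (Summit.BirchSwinnertonDyer.Rank1Residual.X11b.Halves.toUnr 3)) = Ideal.span {F} →
    ∃ C : ℕ, ∀ x : ℂ_[3], IsBDPPoint ι' κ γ x → ∀ vF vL : ℂ_[3], F.HasValueAt x vF → L.HasValueAt x vL →
      ‖vL‖ ≤ (3 : ℝ) ^ C * ‖vF‖

/-- **D [WEAKER · ATTACKABLE (S/M)]** the accumulation door: value domination `‖L‖ ≤ 3^C·‖F‖` on a subset of the open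
disc accumulating at an interior point `x₀` forces `ord_{x₀} L ≥ ord_{x₀} F` (`L/F` is bounded on a set accumulating
at `x₀`, so it has no pole there). -/
def AccumulationDoorAtThree : Prop :=
  ∀ (F L : UnrSeries 3) (S : Set ℂ_[3]) (x₀ : ℂ_[3]), ‖x₀‖ < 1 → x₀ ∈ closure (S \ {x₀}) → (∀ x ∈ S, ‖x‖ < 1) →
    (∃ C : ℕ, ∀ x ∈ S, ∀ vF vL : ℂ_[3], F.HasValueAt x vF → L.HasValueAt x vL → ‖vL‖ ≤ (3 : ℝ) ^ C * ‖vF‖) →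
    ∀ n : ℕ, VanishesToOrder F x₀ n → VanishesToOrder L x₀ n

/-- **P's reach [WEAKER · consequence of P, D and accumulation; its complement — roots of `F` OFF the closure of the
BDP points — is BARRIER B-g7-1 and is exactly what S ∧ I removes]** on-closure root transfer: at every interior
accumulation point `x₀` of the BDP points, `ord_{x₀} L ≥ ord_{x₀} F`. -/
def OnClosureRootTransferAtThree : Prop :=
  ∀ (W : WeierstrassCurve ℚ) [W.IsElliptic] [W.IsGloballyMinimal] (N : ℕ) [NeZero N] (K : Type) [Field K] [NumberField K] (Dt : Literature.NumberTheory.EllipticCurves.ModularForms.ModularParametrizationData W N), Summit.BirchSwinnertonDyer.Rank1Residual.Additive.ClassO6 W 3 → W.HasSurjectiveModNGaloisRep 3 → W.analyticRank = 1 → W.conductorNorm ℤ = N → Literature.NumberTheory.EllipticCurves.IsImaginaryQuadratic K → Literature.NumberTheory.EllipticCurves.SatisfiesHeegnerHypothesis N K → ∀ (κ : Literature.NumberTheory.EllipticCurves.ZpExtension K 3), κ.IsAnticyclotomic → ∀ (γ : Field.absoluteGaloisGroup K) [Fact (κ.IsTopGenerator γ)] (𝔭 : IsDedekindDomain.HeightOneSpectrum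 (NumberField.RingOfIntegers K)), ((3 : ℕ) : NumberField.RingOfIntegers K) ∈ 𝔭.asIdeal → 𝔭.asIdeal.ramificationIdx (NumberField.RingOfIntegers ℚ) = 1 → 𝔭.asIdeal.inertiaDeg (NumberField.RingOfIntegers ℚ) = 1 → ∀ (𝔭' : IsDedekindDomain.HeightOneSpectrum (NumberField.RingOfIntegers K)), ((3 : ℕ) : NumberField.RingOfIntegers K) ∈ 𝔭'.asIdeal → 𝔭' ≠ 𝔭 → ∀ (ι' : PadicAlgCl 3 ≃+* ℂ), Summit.BirchSwinnertonDyer.BirchSwinnertonDyer.Theorems.SchneiderFree.BranchInducesPrime 3 ι' 𝔭 → ∀ (ΩK : ℂ) (Ωp : ℂ_[3]) (L : Literature.NumberTheory.EllipticCurves.UnrSeries 3), ΩK ≠ 0 → Ωp ≠ 0 → Literature.NumberTheory.EllipticCurves.IsBDPLFunction ι' 𝔭 κ γ Dt.f ΩK Ωp L → Module.IsTorsion (Literature.NumberTheory.EllipticCurves.IwasawaAlgebra 3) (Summit.BirchSwinnertonDyer.Rank1Residual.X11b.AcSelmer.XAc (W.baseChange K) 3 κ 𝔭' ∅ γ) →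 ∀ F : Literature.NumberTheory.EllipticCurves.UnrSeries 3, (Summit.BirchSwinnertonDyer.Rank1Residual.X11b.AcSelmer.XAc.charIdeal (W.baseChange K) 3 κ 𝔭' ∅ γ).map (PowerSeries.map (Summit.BirchSwinnertonDyer.Rank1Residual.X11b.Halves.toUnr 3)) = Ideal.span {F} →
    ∀ x₀ : ℂ_[3], ‖x₀‖ < 1 → x₀ ∈ closure ({x : ℂ_[3] | IsBDPPoint ι' κ γ x ∧ ‖x‖ < 1} \ {x₀}) →
      ∀ n : ℕ, VanishesToOrder F x₀ n → VanishesToOrder L x₀ n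

/-! ### Kernel-checked compositions -/

/-- **I₁ ∧ I₂ ⟹ I.** -/
theorem identityPrincipleAtBDPPoints_of_accumulate_of_strassmann
    (h1 : BDPPointsAccumulateAtThree) (h2 : StrassmannIdentityAtThree) :
    IdentityPrincipleAtBDPPointsAtThree := by
  intro K _ _ hK κ hκ γ _ ι G H hGH
  obtain ⟨x₀, hx₀, hacc⟩ := h1 K hK κ hκ γ ι
  exact h2 {x : ℂ_[3] | IsBDPPoint ι κ γ x ∧ ‖x‖ < 1} x₀ hx₀ hacc (fun x hx ↦ hx.2) G H
    (fun x hx v w hv hw ↦ hGH x hx.1 v w hv hw)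

/-- **P ∧ D ⟹ on-closure root transfer** (the WEAKER first target of the line and its reach). -/
theorem onClosureRootTransferAtThree_of_domination_of_door
    (hP : UniformValueDominationAtBDPPointsAtThree) (hD : AccumulationDoorAtThree) :
    OnClosureRootTransferAtThree := by
  intro W _ _ N _ K _ _ Dt hO6 hsurj hr1 hN hK hH κ hκ γ _ 𝔭 h𝔭 he hf 𝔭' h𝔭' hne ι' hι ΩK Ωp L hΩK hΩp hL
    htor F hF x₀ hx₀ hacc n hFn
  obtain ⟨C, hC⟩ := hP W N K Dt hO6 hsurj hr1 hN hK hH κ hκ γ 𝔭 h𝔭 he hf 𝔭' h𝔭' hne ι' hι ΩK Ωp L hΩK hΩp hL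
    htor F hF
  exact hD F L {x : ℂ_[3] | IsBDPPoint ι' κ γ x ∧ ‖x‖ < 1} x₀ hx₀ hacc (fun x hx ↦ hx.2)
    ⟨C, fun x hx vF vL hvF hvL ↦ hC x hx.1 vF vL hvF hvL⟩ n hFn

/-- **The idea's composition (kernel, BY NAME): S ∧ I ⟹ 24207.**  `G ≡ u·L` at the BDP points and **I** give
`G = u·L`; then `3ᵏ·G = u·(3ᵏ·L) ∈ Ch·R₀⟦T⟧` and `u` is a unit, so `3ᵏ·L ∈ Ch·R₀⟦T⟧`. -/
theorem rationalSplitIMCInclusionAtThree_of_sweep_of_identity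
    (hS : EndoscopicSweepSupplyAtThree) (hI : IdentityPrincipleAtBDPPointsAtThree) :
    Summit.BirchSwinnertonDyer.BirchSwinnertonDyer.Theses.UniversalToricDescent.RationalSplitIMCInclusionAtThree := by
  intro W _ _ N _ K _ _ Dt hO6 hsurj hr1 hN hK hH κ hκ γ _ 𝔭 h𝔭 he hf 𝔭' h𝔭' hne ι' hι ΩK Ωp L hΩK hΩp hL
  obtain ⟨G, u, k, hu, hG, hagree⟩ :=
    hS W N K Dt hO6 hsurj hr1 hN hK hH κ hκ γ 𝔭 h𝔭 he hf 𝔭' h𝔭' hne ι' hι ΩK Ωp L hΩK hΩp hL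
  have hGL : G = u * L := hI K hK κ hκ γ ι' G (u * L) hagree
  refine ⟨k, ?_⟩
  have hmem : u * (((3 : ℕ) : UnrSeries 3) ^ k * L) ∈
      (AcSelmer.XAc.charIdeal (W.baseChange K) 3 κ 𝔭' ∅ γ).map (PowerSeries.map (Halves.toUnr 3)) := by
    have heq : ((3 : ℕ) : UnrSeries 3) ^ k * G = u * (((3 : ℕ) : UnrSeries 3) ^ k * L) := by
      rw [hGL]; ring
    rw [← heq]; exact hG
  exact (Ideal.unit_mul_mem_iff_mem _ hu).mp hmem

/-- **I₁ ∧ I₂ ∧ S ⟹ 24207** (all typed leaves of the main composition at once). -/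
theorem rationalSplitIMCInclusionAtThree_of_sweep_of_accumulate_of_strassmann
    (hS : EndoscopicSweepSupplyAtThree) (h1 : BDPPointsAccumulateAtThree) (h2 : StrassmannIdentityAtThree) :
    Summit.BirchSwinnertonDyer.BirchSwinnertonDyer.Theses.UniversalToricDescent.RationalSplitIMCInclusionAtThree :=
  rationalSplitIMCInclusionAtThree_of_sweep_of_identity hS
    (identityPrincipleAtBDPPoints_of_accumulate_of_strassmann h1 h2)

/-- **Costume check, recorded (S is a DOOR-HALF, not weaker): 24207 ⟹ S** with `G = L`, `u = 1`, by uniqueness of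
values. -/
theorem endoscopicSweepSupplyAtThree_of_rationalSplitIMCInclusionAtThree
    (h : Summit.BirchSwinnertonDyer.BirchSwinnertonDyer.Theses.UniversalToricDescent.RationalSplitIMCInclusionAtThree) :
    EndoscopicSweepSupplyAtThree := by
  intro W _ _ N _ K _ _ Dt hO6 hsurj hr1 hN hK hH κ hκ γ _ 𝔭 h𝔭 he hf 𝔭' h𝔭' hne ι' hι ΩK Ωp L hΩK hΩp hL
  obtain ⟨k, hk⟩ := h W N K Dt hO6 hsurj hr1 hN hK hH κ hκ γ 𝔭 h𝔭 he hf 𝔭' h𝔭' hne ι' hι ΩK Ωp L hΩK hΩp hL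
  refine ⟨L, 1, k, isUnit_one, hk, ?_⟩
  intro x _ v w hv hw
  rw [one_mul] at hw
  exact hv.unique hw

end Summit.BirchSwinnertonDyer.BirchSwinnertonDyer.Cruxes.RationalSplitIMCInclusionAtThree.EndoscopicAccumulatingReciprocity
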